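import Mathlib
import HarnessLib
import Summits.KontsevichZagierPeriods.Zeta5Search.Denom.KernelStripStep
import Summits.KontsevichZagierPeriods.Zeta5Search.Denom.KernelSechSq

/-!
# The unit strip step for the squared Barnes kernel WITH the residue (`(π/sin πt)²`)

HONEST FRAMING: systematic search; no irrationality claim unless certified.  Pure complex analysis; no
arithmetic and no claim about any zeta value is made here.

`KernelStripStep.integral_kernel_step` moves the vertical line of `∫ (π/sin πt)² g(t) dt` across an
integer `m` at which `g` has a DOUBLE zero.  This file removes the vanishing hypotheses: for `g`
holomorphic on the closed strip `|Re t − m| ≤ ½` with polynomial growth,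

  `∫ (π/sin π(m−½+iy))² g(m−½+iy) dy = ∫ (π/sin π(m+½+iy))² g(m+½+iy) dy − 2π·g′(m)`

(`integral_kernel_residue_step`): the residue of `(π/sin πt)² g(t)` at the double pole `t = m` is
`g′(m)` (the Laurent expansion of `(π/sin πt)²` at an integer has no `1/(t−m)` term).  Proof: write
`g = g(m) + g′(m)(t − m) + r` with `r` vanishing to order two, apply the double-zero step to `r`, and
evaluate the two model integrals in closed form — on the half-integer lines the kernel is the real
profile `π²/cosh²(πy)` (`KernelSechSq.kernel_halfLine`), so the constant term contributes equally on both
lines and the linear term contributes `∫_ℝ π²/cosh²(πy) dy = 2π` (`KernelSechSq.integral_sechSq`).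
Iterating from the line `Re t = ½` gives [Zudilin2014ZetaTwo, Lemma 1] (arXiv:1310.1526) by the Pascal
recursion, and Lemma 2 by stepping to the right (separate files).
-/

noncomputable section

open Complex Set MeasureTheory Filter Topology
open Summit.KontsevichZagierPeriods.Zeta5Search.Denom.KernelStripStep
open Summit.KontsevichZagierPeriods.Zeta5Search.Denom.KernelSechSq

namespace Summit.KontsevichZagierPeriods.Zeta5Search.Denom.KernelResidueStep

/-! ### The residue step -/

/-- A point of the line `Re t = x`, `|x − m| ≤ ½`, lies in `halfStrip m`, with imaginary part `y`. -/
theorem line_mem_halfStrip {m : ℤ} {x : ℝ} (hx : x ∈ Icc ((m : ℝ) - 1 / 2) ((m : ℝ) + 1 / 2)) (y : ℝ) :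
    (x : ℂ) + (y : ℂ) * I ∈ halfStrip m := by
  simpa [halfStrip] using hx

/-- On `halfStrip m`: `‖t − m‖ ≤ 1 + (Im t)²`. -/
theorem norm_sub_intCast_le {m : ℤ} {t : ℂ} (ht : t ∈ halfStrip m) : ‖t - m‖ ≤ 1 + t.im ^ 2 := by
  simp only [halfStrip, mem_preimage, mem_Icc] at ht
  have h1 : ‖t - m‖ ≤ |(t - m).re| + |(t - m).im| := norm_le_abs_re_add_abs_im _
  have h2 : |(t - m).re| ≤ 1 / 2 := by
    rw [sub_re, intCast_re, abs_le]
    constructor <;> linarith [ht.1, ht.2]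
  have h3 : (t - (m : ℂ)).im = t.im := by simp
  rw [h3] at h1
  nlinarith [sq_nonneg (|t.im| - 1 / 2), sq_abs t.im, abs_nonneg t.im]

/-- **The residue step.**  For `g` holomorphic on the closed strip `|Re t − m| ≤ ½` with polynomial growth,
moving the line of `∫ (π/sin πt)² g(t)` from `Re t = m − ½` to `Re t = m + ½` costs the residue `2π g′(m)`:
`∫ K(m−½+iy) g(m−½+iy) dy = ∫ K(m+½+iy) g(m+½+iy) dy − 2π·g′(m)`. -/
theorem integral_kernel_residue_step {g : ℂ → ℂ} {m : ℤ} {A : ℝ} {N : ℕ}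
    (hg : DifferentiableOn ℂ g (halfStrip m)) (hA : ∀ t ∈ halfStrip m, ‖g t‖ ≤ A * (1 + t.im ^ 2) ^ N) :
    ∫ y : ℝ, ((Real.pi : ℂ) / Complex.sin (Real.pi * ((((m : ℝ) - 1 / 2 : ℝ) : ℂ) + (y : ℂ) * I))) ^ 2 *
        g ((((m : ℝ) - 1 / 2 : ℝ) : ℂ) + (y : ℂ) * I) =
      (∫ y : ℝ, ((Real.pi : ℂ) / Complex.sin (Real.pi * ((((m : ℝ) + 1 / 2 : ℝ) : ℂ) + (y : ℂ) * I))) ^ 2 *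
        g ((((m : ℝ) + 1 / 2 : ℝ) : ℂ) + (y : ℂ) * I)) - 2 * Real.pi * deriv g m := by
  -- Taylor data at `m` and the remainder `r`
  have hgd : DifferentiableAt ℂ g m := hg.differentiableAt (halfStrip_mem_nhds m)
  have hA0 : 0 ≤ A := by
    have h := hA (m : ℂ) (by simp [halfStrip])
    simp only [intCast_im, ne_eq, OfNat.ofNat_ne_zero, not_false_eq_true, zero_pow, add_zero, one_pow,
      mul_one] at h
    exact (norm_nonneg _).trans h
  have hrD : DifferentiableOn ℂ (fun t => g t - g m - deriv g m * (t - m)) (halfStrip m) := by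
    fun_prop
  have hr0 : (fun t => g t - g m - deriv g m * (t - m)) m = 0 := by simp
  have hr1 : deriv (fun t => g t - g m - deriv g m * (t - m)) m = 0 := by
    have hd : HasDerivAt (fun t => g t - g m - deriv g m * (t - m)) (deriv g m - deriv g m * 1) m :=
      (hgd.hasDerivAt.sub_const (g m)).sub (((hasDerivAt_id' (m : ℂ)).sub_const (m : ℂ)).const_mul _)
    rw [hd.deriv]
    ring
  have hrA : ∀ t ∈ halfStrip m, ‖(fun t => g t - g m - deriv g m * (t - m)) t‖ ≤
      (A + ‖g m‖ + ‖deriv g m‖) * (1 + t.im ^ 2) ^ (N + 1) := by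
    intro t ht
    have hq : (1 : ℝ) ≤ 1 + t.im ^ 2 := by nlinarith [sq_nonneg t.im]
    have h1 : ‖g t - g m - deriv g m * (t - m)‖ ≤ ‖g t‖ + ‖g m‖ + ‖deriv g m‖ * ‖t - m‖ := by
      calc ‖g t - g m - deriv g m * (t - m)‖ ≤ ‖g t - g m‖ + ‖deriv g m * (t - m)‖ := norm_sub_le _ _
        _ ≤ ‖g t‖ + ‖g m‖ + ‖deriv g m‖ * ‖t - m‖ := by
            rw [norm_mul]
            gcongr
            exact norm_sub_le _ _
    have h2 := norm_sub_intCast_le ht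
    have h3 := hA t ht
    have e1 : (1 + t.im ^ 2) ^ N ≤ (1 + t.im ^ 2) ^ (N + 1) := pow_le_pow_right₀ hq (by omega)
    have e2 : (1 : ℝ) ≤ (1 + t.im ^ 2) ^ (N + 1) := one_le_pow₀ hq
    have e3 : 1 + t.im ^ 2 ≤ (1 + t.im ^ 2) ^ (N + 1) := le_self_pow₀ hq (by omega)
    have hn0 : 0 ≤ ‖g m‖ := norm_nonneg _
    have hn1 : 0 ≤ ‖deriv g m‖ := norm_nonneg _
    calc ‖g t - g m - deriv g m * (t - m)‖ ≤ ‖g t‖ + ‖g m‖ + ‖deriv g m‖ * ‖t - m‖ := h1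
      _ ≤ A * (1 + t.im ^ 2) ^ N + ‖g m‖ + ‖deriv g m‖ * (1 + t.im ^ 2) := by gcongr
      _ ≤ A * (1 + t.im ^ 2) ^ (N + 1) + ‖g m‖ * (1 + t.im ^ 2) ^ (N + 1) +
            ‖deriv g m‖ * (1 + t.im ^ 2) ^ (N + 1) := by
          nlinarith [mul_le_mul_of_nonneg_left e1 hA0, mul_le_mul_of_nonneg_left e2 hn0,
            mul_le_mul_of_nonneg_left e3 hn1]
      _ = (A + ‖g m‖ + ‖deriv g m‖) * (1 + t.im ^ 2) ^ (N + 1) := by ring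
  -- the double-zero step for `r`
  have step := integral_kernel_step hrD hr0 hr1 hrA
  beta_reduce at step
  -- the kernel on the two lines
  have kL : ∀ y : ℝ, ((Real.pi : ℂ) / Complex.sin (Real.pi * ((((m : ℝ) - 1 / 2 : ℝ) : ℂ) + (y : ℂ) * I))) ^ 2 =
      ((sechSq y : ℝ) : ℂ) := fun y => kernel_halfLine (cos_pi_mul_intCast_sub_half m) y
  have kR : ∀ y : ℝ, ((Real.pi : ℂ) / Complex.sin (Real.pi * ((((m : ℝ) + 1 / 2 : ℝ) : ℂ) + (y : ℂ) * I))) ^ 2 =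
      ((sechSq y : ℝ) : ℂ) := fun y => kernel_halfLine (cos_pi_mul_intCast_add_half m) y
  simp only [kL, kR] at step ⊢
  -- membership / imaginary parts on the lines
  have hxL : ((m : ℝ) - 1 / 2) ∈ Icc ((m : ℝ) - 1 / 2) ((m : ℝ) + 1 / 2) := ⟨le_rfl, by linarith⟩
  have hxR : ((m : ℝ) + 1 / 2) ∈ Icc ((m : ℝ) - 1 / 2) ((m : ℝ) + 1 / 2) := ⟨by linarith, le_rfl⟩
  have memL : ∀ y : ℝ, (((m : ℝ) - 1 / 2 : ℝ) : ℂ) + (y : ℂ) * I ∈ halfStrip m := line_mem_halfStrip hxL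
  have memR : ∀ y : ℝ, (((m : ℝ) + 1 / 2 : ℝ) : ℂ) + (y : ℂ) * I ∈ halfStrip m := line_mem_halfStrip hxR
  have imL : ∀ y : ℝ, ((((m : ℝ) - 1 / 2 : ℝ) : ℂ) + (y : ℂ) * I).im = y := fun y => by simp
  have imR : ∀ y : ℝ, ((((m : ℝ) + 1 / 2 : ℝ) : ℂ) + (y : ℂ) * I).im = y := fun y => by simp
  -- integrability of the pieces
  have cL : Continuous fun y : ℝ => (((m : ℝ) - 1 / 2 : ℝ) : ℂ) + (y : ℂ) * I := by fun_prop
  have cR : Continuous fun y : ℝ => (((m : ℝ) + 1 / 2 : ℝ) : ℂ) + (y : ℂ) * I := by fun_prop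
  have IgL : Integrable fun y : ℝ => ((sechSq y : ℝ) : ℂ) * g ((((m : ℝ) - 1 / 2 : ℝ) : ℂ) + (y : ℂ) * I) :=
    integrable_sechSq_mul (hg.continuousOn.comp_continuous cL memL) fun y => by
      simpa [imL y] using hA _ (memL y)
  have IgR : Integrable fun y : ℝ => ((sechSq y : ℝ) : ℂ) * g ((((m : ℝ) + 1 / 2 : ℝ) : ℂ) + (y : ℂ) * I) :=
    integrable_sechSq_mul (hg.continuousOn.comp_continuous cR memR) fun y => by
      simpa [imR y] using hA _ (memR y)
  have IrL : Integrable fun y : ℝ => ((sechSq y : ℝ) : ℂ) *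
      (g ((((m : ℝ) - 1 / 2 : ℝ) : ℂ) + (y : ℂ) * I) - g m -
        deriv g m * ((((m : ℝ) - 1 / 2 : ℝ) : ℂ) + (y : ℂ) * I - m)) :=
    integrable_sechSq_mul (hrD.continuousOn.comp_continuous cL memL) fun y => by
      simpa [imL y] using hrA _ (memL y)
  have IrR : Integrable fun y : ℝ => ((sechSq y : ℝ) : ℂ) *
      (g ((((m : ℝ) + 1 / 2 : ℝ) : ℂ) + (y : ℂ) * I) - g m -
        deriv g m * ((((m : ℝ) + 1 / 2 : ℝ) : ℂ) + (y : ℂ) * I - m)) :=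
    integrable_sechSq_mul (hrD.continuousOn.comp_continuous cR memR) fun y => by
      simpa [imR y] using hrA _ (memR y)
  have I0 : Integrable fun y : ℝ => ((sechSq y : ℝ) : ℂ) := integrable_sechSq.ofReal
  have hlin : ∀ (x : ℝ), x ∈ Icc ((m : ℝ) - 1 / 2) ((m : ℝ) + 1 / 2) →
      ∀ y : ℝ, ‖(x : ℂ) + (y : ℂ) * I - m‖ ≤ 1 * (1 + y ^ 2) ^ 1 := by
    intro x hx y
    have h := norm_sub_intCast_le (line_mem_halfStrip hx y)
    simpa using h
  have I1L : Integrable fun y : ℝ => ((sechSq y : ℝ) : ℂ) * ((((m : ℝ) - 1 / 2 : ℝ) : ℂ) + (y : ℂ) * I - m) :=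
    integrable_sechSq_mul (by fun_prop) (hlin _ hxL)
  have I1R : Integrable fun y : ℝ => ((sechSq y : ℝ) : ℂ) * ((((m : ℝ) + 1 / 2 : ℝ) : ℂ) + (y : ℂ) * I - m) :=
    integrable_sechSq_mul (by fun_prop) (hlin _ hxR)
  -- decompose both line integrals
  have eqL : ∫ y : ℝ, ((sechSq y : ℝ) : ℂ) * g ((((m : ℝ) - 1 / 2 : ℝ) : ℂ) + (y : ℂ) * I) =
      (∫ y : ℝ, ((sechSq y : ℝ) : ℂ) *
        (g ((((m : ℝ) - 1 / 2 : ℝ) : ℂ) + (y : ℂ) * I) - g m -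
          deriv g m * ((((m : ℝ) - 1 / 2 : ℝ) : ℂ) + (y : ℂ) * I - m))) +
      g m * (∫ y : ℝ, ((sechSq y : ℝ) : ℂ)) +
      deriv g m * ∫ y : ℝ, ((sechSq y : ℝ) : ℂ) * ((((m : ℝ) - 1 / 2 : ℝ) : ℂ) + (y : ℂ) * I - m) := by
    have s1 : ∫ y : ℝ, (((sechSq y : ℝ) : ℂ) *
        (g ((((m : ℝ) - 1 / 2 : ℝ) : ℂ) + (y : ℂ) * I) - g m -
          deriv g m * ((((m : ℝ) - 1 / 2 : ℝ) : ℂ) + (y : ℂ) * I - m)) + g m * ((sechSq y : ℝ) : ℂ)) =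
        (∫ y : ℝ, ((sechSq y : ℝ) : ℂ) *
          (g ((((m : ℝ) - 1 / 2 : ℝ) : ℂ) + (y : ℂ) * I) - g m -
            deriv g m * ((((m : ℝ) - 1 / 2 : ℝ) : ℂ) + (y : ℂ) * I - m))) +
        ∫ y : ℝ, g m * ((sechSq y : ℝ) : ℂ) := integral_add IrL (I0.const_mul _)
    have s2 : ∫ y : ℝ, ((((sechSq y : ℝ) : ℂ) *
        (g ((((m : ℝ) - 1 / 2 : ℝ) : ℂ) + (y : ℂ) * I) - g m -
          deriv g m * ((((m : ℝ) - 1 / 2 : ℝ) : ℂ) + (y : ℂ) * I - m)) + g m * ((sechSq y : ℝ) : ℂ)) +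
        deriv g m * (((sechSq y : ℝ) : ℂ) * ((((m : ℝ) - 1 / 2 : ℝ) : ℂ) + (y : ℂ) * I - m))) =
        (∫ y : ℝ, (((sechSq y : ℝ) : ℂ) *
          (g ((((m : ℝ) - 1 / 2 : ℝ) : ℂ) + (y : ℂ) * I) - g m -
            deriv g m * ((((m : ℝ) - 1 / 2 : ℝ) : ℂ) + (y : ℂ) * I - m)) + g m * ((sechSq y : ℝ) : ℂ))) +
        ∫ y : ℝ, deriv g m * (((sechSq y : ℝ) : ℂ) * ((((m : ℝ) - 1 / 2 : ℝ) : ℂ) + (y : ℂ) * I - m)) :=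
      integral_add (IrL.add (I0.const_mul _)) (I1L.const_mul _)
    rw [s1, integral_const_mul, integral_const_mul] at s2
    rw [← s2]
    congr 1
    funext y
    ring
  have eqR : ∫ y : ℝ, ((sechSq y : ℝ) : ℂ) * g ((((m : ℝ) + 1 / 2 : ℝ) : ℂ) + (y : ℂ) * I) =
      (∫ y : ℝ, ((sechSq y : ℝ) : ℂ) *
        (g ((((m : ℝ) + 1 / 2 : ℝ) : ℂ) + (y : ℂ) * I) - g m -
          deriv g m * ((((m : ℝ) + 1 / 2 : ℝ) : ℂ) + (y : ℂ) * I - m))) +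
      g m * (∫ y : ℝ, ((sechSq y : ℝ) : ℂ)) +
      deriv g m * ∫ y : ℝ, ((sechSq y : ℝ) : ℂ) * ((((m : ℝ) + 1 / 2 : ℝ) : ℂ) + (y : ℂ) * I - m) := by
    have s1 : ∫ y : ℝ, (((sechSq y : ℝ) : ℂ) *
        (g ((((m : ℝ) + 1 / 2 : ℝ) : ℂ) + (y : ℂ) * I) - g m -
          deriv g m * ((((m : ℝ) + 1 / 2 : ℝ) : ℂ) + (y : ℂ) * I - m)) + g m * ((sechSq y : ℝ) : ℂ)) =
        (∫ y : ℝ, ((sechSq y : ℝ) : ℂ) *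
          (g ((((m : ℝ) + 1 / 2 : ℝ) : ℂ) + (y : ℂ) * I) - g m -
            deriv g m * ((((m : ℝ) + 1 / 2 : ℝ) : ℂ) + (y : ℂ) * I - m))) +
        ∫ y : ℝ, g m * ((sechSq y : ℝ) : ℂ) := integral_add IrR (I0.const_mul _)
    have s2 : ∫ y : ℝ, ((((sechSq y : ℝ) : ℂ) *
        (g ((((m : ℝ) + 1 / 2 : ℝ) : ℂ) + (y : ℂ) * I) - g m -
          deriv g m * ((((m : ℝ) + 1 / 2 : ℝ) : ℂ) + (y : ℂ) * I - m)) + g m * ((sechSq y : ℝ) : ℂ)) +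
        deriv g m * (((sechSq y : ℝ) : ℂ) * ((((m : ℝ) + 1 / 2 : ℝ) : ℂ) + (y : ℂ) * I - m))) =
        (∫ y : ℝ, (((sechSq y : ℝ) : ℂ) *
          (g ((((m : ℝ) + 1 / 2 : ℝ) : ℂ) + (y : ℂ) * I) - g m -
            deriv g m * ((((m : ℝ) + 1 / 2 : ℝ) : ℂ) + (y : ℂ) * I - m)) + g m * ((sechSq y : ℝ) : ℂ))) +
        ∫ y : ℝ, deriv g m * (((sechSq y : ℝ) : ℂ) * ((((m : ℝ) + 1 / 2 : ℝ) : ℂ) + (y : ℂ) * I - m)) :=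
      integral_add (IrR.add (I0.const_mul _)) (I1R.const_mul _)
    rw [s1, integral_const_mul, integral_const_mul] at s2
    rw [← s2]
    congr 1
    funext y
    ring
  -- the model integral of the linear term
  have base : (∫ y : ℝ, ((sechSq y : ℝ) : ℂ) * ((((m : ℝ) + 1 / 2 : ℝ) : ℂ) + (y : ℂ) * I - m)) -
      (∫ y : ℝ, ((sechSq y : ℝ) : ℂ) * ((((m : ℝ) - 1 / 2 : ℝ) : ℂ) + (y : ℂ) * I - m)) =
      2 * (Real.pi : ℂ) := by
    rw [← integral_sub I1R I1L]
    have h : ∀ y : ℝ, ((sechSq y : ℝ) : ℂ) * ((((m : ℝ) + 1 / 2 : ℝ) : ℂ) + (y : ℂ) * I - m) -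
        ((sechSq y : ℝ) : ℂ) * ((((m : ℝ) - 1 / 2 : ℝ) : ℂ) + (y : ℂ) * I - m) = ((sechSq y : ℝ) : ℂ) := by
      intro y
      push_cast
      ring
    simp_rw [h]
    rw [integral_complex_ofReal, integral_sechSq]
    push_cast
    ring
  rw [eqL, eqR, step]
  linear_combination (-(deriv g m)) * base

/-- **The residue step with a real base point** `x = m − ½`: lines `Re t = x` and `Re t = x + 1`. -/
theorem integral_kernel_residue_step_real {g : ℂ → ℂ} {m : ℤ} {x A : ℝ} {N : ℕ}
    (hx : x = (m : ℝ) - 1 / 2) (hg : DifferentiableOn ℂ g (halfStrip m))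
    (hA : ∀ t ∈ halfStrip m, ‖g t‖ ≤ A * (1 + t.im ^ 2) ^ N) :
    ∫ y : ℝ, ((Real.pi : ℂ) / Complex.sin (Real.pi * ((x : ℂ) + (y : ℂ) * I))) ^ 2 * g ((x : ℂ) + (y : ℂ) * I) =
      (∫ y : ℝ, ((Real.pi : ℂ) / Complex.sin (Real.pi * (((x + 1 : ℝ) : ℂ) + (y : ℂ) * I))) ^ 2 *
        g (((x + 1 : ℝ) : ℂ) + (y : ℂ) * I)) - 2 * Real.pi * deriv g m := by
  subst hx
  have e2 : (m : ℝ) - 1 / 2 + 1 = (m : ℝ) + 1 / 2 := by ring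
  rw [e2]
  exact integral_kernel_residue_step hg hA

end Summit.KontsevichZagierPeriods.Zeta5Search.Denom.KernelResidueStep

end
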